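import Summits.AtomisticToContinuum.HydrodynamicLimit.Theorems.RelayRaceLocalityNearConstantShortTimeHLOrbitExpansion
import Summits.AtomisticToContinuum.HydrodynamicLimit.Theorems.RelayRaceLocalityNearConstantShortTimeHLFluxRemainder
import Summits.AtomisticToContinuum.HydrodynamicLimit.Theorems.RelayRaceLocalityNearConstantShortTimeHLEulerSide
import Summits.AtomisticToContinuum.HydrodynamicLimit.Theorems.RelayRaceLocalityNearConstantShortTimeHLOrbitIntegrabilityB
import Summits.AtomisticToContinuum.HydrodynamicLimit.Theorems.RelayRaceLocalityNearConstantShortTimeHLFluxIntegrabilityB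
import Summits.AtomisticToContinuum.HydrodynamicLimit.Theorems.RelayRaceLocalityNearConstantShortTimeHLDerivContinuity
import HarnessLib

/-!
# Crux `NearConstantShortTimeHL` (stmt-AtomisticToContinuum-12502), line `small-tilt-domination`:
# stub `window_pathwise` — the pathwise window bound of the relative-entropy Grönwall

Lead c4, wave 2b, stub `window_pathwise` of the Grönwall assembly (route: Yau's relative-entropy
method for deterministic hard spheres, energy-weighted mesoscale fluctuation functional).  Along ONE
good hard-sphere orbit `r ↦ Φ_r z` obeying the ball-packing cap `ρ̃σ³ ≤ η₁ < η₀` on a window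
`[s, s+τ] ⊆ [0, t]`, the increment of the log-profile observable `X` minus the increment of the
static Euler mean `m^{st}(r) = ∫ ρ_r (log ρ_r + g_σ(ρ_r) − 3/2 log(2πθ_r) − 3/2) dx` equals the two
closure defects up to the flux remainder and the commutator error:

`|X_{s+τ} − X_s − (m^{st}(s+τ) − m^{st}(s)) − momDefect − enDefect|`
`  ≤ C(1+L) ∫_s^{s+τ} fluctuationE_r(Φ_r z) dr + C ∫_s^{s+τ} cubicTail_L(Φ_r z) dr + τ ω (4 + 6K(z))`.

Proof (pure composition of landed pieces):
* the trajectory expansion `logProfileObs_orbit_expansion` gives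
  `|X_{s+τ} − X_s − ∫_s^{s+τ}∫ₓ ballRate − momDefect − enDefect| ≤ τ ω (4 + 6K)`; its integrability
  inputs are discharged on the window: the rows are jointly smooth on a horizon slab `[0, t')`,
  `t < t' ≤ T` (`exists_horizon_of_packing_lt`, `isSmoothSpaceTimeOn_logProfileRows`), so the window
  time derivatives are jointly continuous (`continuousOn_derivs_of_isSmoothSpaceTimeOn`,
  `wc_timeDerivWithin_window`) and `intervalIntegrable_momFlux_orbit` / `intervalIntegrable_enFlux_orbit`
  (with `S := [s, s+τ]`), `integrable_momFlux` / `integrable_enFlux`,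
  `intervalIntegrable_integral_ballRate_orbit` and the slice integrability of
  `integral_abs_ballRate_sub_eulerRate_le` apply;
* the Euler side `integral_logProfileStatic_sub_eq`: `m^{st}(s+τ) − m^{st}(s) = ∫_s^{s+τ}∫ₓ eulerRate`;
* the flux remainder `integral_abs_ballRate_sub_eulerRate_le`, pointwise in `r` and integrated over
  the window (`intervalIntegral.abs_integral_le_integral_abs`, `intervalIntegral.integral_mono_on`);
* the triangle inequality.

No definitions, no named facts.  References: H.-T. Yau, Lett. Math. Phys. 22 (1991) §2; H. Spohn,
*Large Scale Dynamics of Interacting Particles* (1991), Part I §3.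
-/

noncomputable section

namespace Summit.AtomisticToContinuum.HydrodynamicLimit.Theorems.NearConstantShortTimeHL

open scoped BigOperators ENNReal Topology
open MeasureTheory Set Filter
open Literature.MathematicalPhysics.KineticTheory Literature.Analysis.FluidPDE Literature.Analysis.FunctionSpaces

/-! ### Window data of a jointly smooth row -/

/-- **Window data of a row.** For a field jointly smooth on `[0, t') × 𝕋³` and a window `[s, s+τ]`,
`0 ≤ s`, `s + τ < t'`: the slices on the window are smooth, the one-sided time derivative WITHIN
THE WINDOW is jointly continuous on `[s, s+τ] × 𝕋³` (it agrees there with the derivative within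
`[0, t')`, `wc_timeDerivWithin_window`, which is jointly continuous on `[0, s+τ] × 𝕋³`,
`continuousOn_derivs_of_isSmoothSpaceTimeOn`), and so are the spatial partial derivatives.
[folklore] -/
theorem xn_window_data {F' : Type*} [NormedAddCommGroup F'] [NormedSpace ℝ F'] {t' s τ : ℝ}
    {f : ℝ → T3 → F'} (hf : Torus.IsSmoothSpaceTimeOn (Set.Ico 0 t') f) (hs : 0 ≤ s) (hτ : 0 < τ)
    (hst' : s + τ < t') :
    (∀ r ∈ Set.Icc s (s + τ), Torus.IsSmooth (f r)) ∧
      ContinuousOn (fun p : ℝ × T3 => Torus.timeDerivWithin (Set.Icc s (s + τ)) f p.1 p.2)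
        (Set.Icc s (s + τ) ×ˢ Set.univ) ∧
      ∀ i, ContinuousOn (fun p : ℝ × T3 => Torus.partialDeriv i (f p.1) p.2)
        (Set.Icc s (s + τ) ×ˢ Set.univ) := by
  obtain ⟨-, hct, hcx⟩ := continuousOn_derivs_of_isSmoothSpaceTimeOn hf hst'
  have hsub : Set.Icc s (s + τ) ×ˢ (Set.univ : Set T3) ⊆ Set.Icc 0 (s + τ) ×ˢ Set.univ :=
    Set.prod_mono (Set.Icc_subset_Icc_left hs) Subset.rfl
  refine ⟨fun r hr => hf.isSmooth_slice ⟨hs.trans hr.1, hr.2.trans_lt hst'⟩,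
    (hct.mono hsub).congr fun p hp => ?_, fun i => (hcx i).mono hsub⟩
  exact wc_timeDerivWithin_window hf hs hτ hst' le_rfl hp.1 p.2

/-! ### Elementary assembly -/

/-- The final triangle inequality: `X' − X − ΔM − mD − eD = (X' − X − IB − mD − eD) + (IB − IE)` when
`ΔM = IE`. [folklore] -/
theorem xn_assemble {X1 X0 M1 M0 mD eD IB IE A B : ℝ} (h1 : |X1 - X0 - IB - mD - eD| ≤ A)
    (hM : M1 - M0 = IE) (h2 : |IB - IE| ≤ B) : |X1 - X0 - (M1 - M0) - mD - eD| ≤ B + A := by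
  have e : X1 - X0 - (M1 - M0) - mD - eD = (X1 - X0 - IB - mD - eD) + (IB - IE) := by
    rw [hM]; ring
  rw [e]
  exact (abs_add_le _ _).trans (by linarith)

/-! ### The registered stub -/

/-- **Registered stub `window_pathwise`: the pathwise window bound of the relative-entropy
Grönwall.**  Along a classical hard-sphere–Euler solution in the analyticity band on `[0, t]` there is
`C > 0` (the flux-remainder constant of `integral_abs_ballRate_sub_eulerRate_le`) such that for every
good orbit obeying the ball-packing cap `ρ̃σ³ ≤ η₁` on a window `[s, s+τ] ⊆ [0, t]`, every ball radius
`0 < ℓ < 1/2`, truncation level `L ≥ 1` and modulus `ω` of the row derivatives at scale `ℓ`: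
`|X_{s+τ} − X_s − (m^{st}(s+τ) − m^{st}(s)) − momDefect − enDefect| ≤ C(1+L)∫ fluctuationE + C ∫ cubicTail
+ τ ω (4 + 6K(z))` — trajectory expansion (`logProfileObs_orbit_expansion`), Euler side
(`integral_logProfileStatic_sub_eq`), flux remainder integrated over the window, triangle inequality.
[cite: Yau1991, §2] -/
theorem window_pathwise : ∀ {η₀ : ℝ} {F : ℝ → ℝ}, 0 < η₀ → AnalyticOnNhd ℝ F (Set.Ioo (-η₀) η₀) → Set.EqOn hsExcessFreeEnergy F (Set.Ico 0 η₀) → ∀ {σ T : ℝ}, 0 < σ → ∀ {ρ θ : ℝ → T3 → ℝ} {u : ℝ → T3 → V3}, IsHardSphereEulerSolution σ T ρ u θ → ∀ {t : ℝ}, t ∈ Set.Ico 0 T → (∀ s ∈ Set.Icc 0 t, ∀ x, ρ s x * σ ^ 3 < η₀) → ∀ {η₁ : ℝ}, 0 < η₁ → η₁ < η₀ → ∃ C : ℝ, 0 < C ∧ ∀ {ε : ℝ} {n : ℕ} (Φ : HardSphereFlow (Torus.geometry (Fin 3)) ε n) {z : Config n (Fin 3) T3}, z ∈ Φ.good → n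 ≠ 0 → ∀ {s τ : ℝ}, 0 ≤ s → 0 < τ → s + τ ≤ t → ∀ {ℓ : ℝ}, 0 < ℓ → ℓ < 1 / 2 → ∀ {L : ℝ}, 1 ≤ L → ∀ {ω : ℝ}, 0 ≤ ω → (∀ r ∈ Set.Icc s (s + τ), ∀ x y : T3, Torus.euclidDist x y < ℓ → |Torus.timeDerivWithin (Set.Ico 0 T) (lam0Row σ ρ θ u) r x - Torus.timeDerivWithin (Set.Ico 0 T) (lam0Row σ ρ θ u) r y| ≤ ω ∧ ‖Torus.timeDerivWithin (Set.Ico 0 T) (lamRow θ u) r x - Torus.timeDerivWithin (Set.Ico 0 T) (lamRow θ u) r y‖ ≤ ω ∧ |Torus.timeDerivWithin (Set.Ico 0 T) (lam4Row θ) r x - Torus.timeDerivWithin (Set.Ico 0 T) (lam4Row θ) r y| ≤ ω ∧ ∀ k, |Torus.partialDeriv k (lam0Row σ ρ θ u r) x - Torus.partialDeriv k (lam0Row σ ρ θ u r) y| ≤ ω) → packCapOn Φ z (Set.Icc s (s + τ)) ℓ σ η₁ → IntervalIntegrable (fun r => fluctuationE ℓ (ρ r) (θ r) (u r) (Φ.flow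 r z)) volume s (s + τ) → IntervalIntegrable (fun r => cubicTail L (Φ.flow r z)) volume s (s + τ) → |logProfileObs σ ρ θ u (s + τ) (Φ.flow (s + τ) z) - logProfileObs σ ρ θ u s (Φ.flow s z) - ((∫ x, ρ (s + τ) x * (Real.log (ρ (s + τ) x) + gChem σ (ρ (s + τ) x) - 3 / 2 * Real.log (2 * Real.pi * θ (s + τ) x) - 3 / 2)) - (∫ x, ρ s x * (Real.log (ρ s x) + gChem σ (ρ s x) - 3 / 2 * Real.log (2 * Real.pi * θ s x) - 3 / 2))) - momDefect σ Φ z ℓ s τ (lamRow θ u) - enDefect σ Φ z ℓ s τ (lam4Row θ)| ≤ C * (1 + L) * (∫ r in s..(s + τ), fluctuationE ℓ (ρ r) (θ r) (u r) (Φ.flow r z)) + C * (∫ r in s..(s + τ), cubicTail L (Φ.flow r z)) + τ * ω * (4 + 6 * kineticPP z) := by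
  intro η₀ F hη₀ hFa hEq σ T hσ ρ θ u hE t ht hband η₁ hη₁ hη₁₀
  -- the constant: the flux-remainder constant
  obtain ⟨C, hC0, hFR⟩ := integral_abs_ballRate_sub_eulerRate_le hη₀ hFa hEq hσ hE ht hband hη₁ hη₁₀
  obtain ⟨hEcont, hEside⟩ := integral_logProfileStatic_sub_eq hη₀ hFa hEq hσ hE ht hband
  -- a smoothness horizon for the rows
  obtain ⟨t', htt', ht'T, hband'⟩ := exists_horizon_of_packing_lt hE hσ ht hband
  obtain ⟨-, h1, h4⟩ := isSmoothSpaceTimeOn_logProfileRows hη₀ hFa hEq hσ hE ht'T hband'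
  have h1' : Torus.IsSmoothSpaceTimeOn (Set.Ico 0 t') (lamRow θ u) := h1
  have h4' : Torus.IsSmoothSpaceTimeOn (Set.Ico 0 t') (lam4Row θ) := h4
  refine ⟨C, hC0, ?_⟩
  intro ε n Φ z hz hn s τ hs hτ hst ℓ hℓ0 hℓ L hL ω hω hmod hcap hIF hIT
  have hsτ : s ≤ s + τ := by linarith
  have hst' : s + τ < t' := lt_of_le_of_lt hst htt'
  have hwin : Set.Icc s (s + τ) ⊆ Set.Icc 0 t := fun r hr => ⟨hs.trans hr.1, hr.2.trans hst⟩
  have hwin' : Set.Icc s (s + τ) ⊆ Set.Ico 0 t' := fun r hr => ⟨hs.trans hr.1, hr.2.trans_lt hst'⟩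
  -- (1) the integrability inputs of the trajectory expansion
  obtain ⟨hψ, hψt, hψx⟩ := xn_window_data h1' hs hτ hst'
  obtain ⟨hφ, hφt, hφx⟩ := xn_window_data h4' hs hτ hst'
  have hIM := intervalIntegrable_momFlux_orbit hη₀ hFa hEq hσ hη₁ hη₁₀ Φ hz hsτ hℓ0 hℓ hcap hψ hψt hψx
  have hIE := intervalIntegrable_enFlux_orbit hη₀ hFa hEq hσ hη₁ hη₁₀ Φ hz hsτ hℓ0 hℓ hcap hφ hφt hφx
  have hMF : ∀ r ∈ Set.Icc s (s + τ), Integrable (fun x =>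
      (∑ i, ∑ j, (Torus.partialDeriv i (lamRow θ u r) x) j *
        (empiricalMomentumField (Φ.flow r z) (ballKernel ℓ x) i *
          empiricalMomentumField (Φ.flow r z) (ballKernel ℓ x) j /
          empiricalDensityField (Φ.flow r z) (ballKernel ℓ x))) +
      hsPressure σ (empiricalDensityField (Φ.flow r z) (ballKernel ℓ x))
        (2 / 3 * (empiricalEnergyField (Φ.flow r z) (ballKernel ℓ x) /
          empiricalDensityField (Φ.flow r z) (ballKernel ℓ x) -
          ‖empiricalMomentumField (Φ.flow r z) (ballKernel ℓ x)‖ ^ 2 /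
            (2 * empiricalDensityField (Φ.flow r z) (ballKernel ℓ x) ^ 2))) *
        Torus.divergence (lamRow θ u r) x) := fun r hr => by
    have hS : Torus.IsSmooth (lamRow θ u r) := h1'.isSmooth_slice (hwin' hr)
    exact integrable_momFlux σ ℓ (Φ.flow r z)
      (c := fun x i j => (Torus.partialDeriv i (lamRow θ u r) x) j) (d := Torus.divergence (lamRow θ u r))
      (fun i j => ((hS.partialDeriv i).apply j).continuous) hS.divergence.continuous
  have hEF : ∀ r ∈ Set.Icc s (s + τ), Integrable (fun x =>
      (empiricalEnergyField (Φ.flow r z) (ballKernel ℓ x) +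
        hsPressure σ (empiricalDensityField (Φ.flow r z) (ballKernel ℓ x))
          (2 / 3 * (empiricalEnergyField (Φ.flow r z) (ballKernel ℓ x) /
            empiricalDensityField (Φ.flow r z) (ballKernel ℓ x) -
            ‖empiricalMomentumField (Φ.flow r z) (ballKernel ℓ x)‖ ^ 2 /
              (2 * empiricalDensityField (Φ.flow r z) (ballKernel ℓ x) ^ 2)))) *
      (∑ i, (empiricalMomentumField (Φ.flow r z) (ballKernel ℓ x) i /
        empiricalDensityField (Φ.flow r z) (ballKernel ℓ x)) * (Torus.gradient (lam4Row θ r) x) i)) :=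
    fun r hr => by
    have hS : Torus.IsSmooth (lam4Row θ r) := h4'.isSmooth_slice (hwin' hr)
    exact integrable_enFlux σ ℓ (Φ.flow r z) (e := Torus.gradient (lam4Row θ r)) hS.gradient.continuous
  have hIB := intervalIntegrable_integral_ballRate_orbit hη₀ hFa hEq hσ hE ht hband hη₁ hη₁₀ Φ hz hs hsτ hst
    hℓ0 hℓ hcap
  have hsl : ∀ r ∈ Set.Icc s (s + τ), Integrable (fun x => ballRate σ T ρ θ u r ℓ (Φ.flow r z) x) :=
    fun r hr => (hFR r (hwin hr) hℓ0 hℓ hL (Φ.flow r z) (hcap r hr)).1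
  have hexp : |logProfileObs σ ρ θ u (s + τ) (Φ.flow (s + τ) z) - logProfileObs σ ρ θ u s (Φ.flow s z) -
      (∫ r in s..(s + τ), ∫ x, ballRate σ T ρ θ u r ℓ (Φ.flow r z) x) -
      momDefect σ Φ z ℓ s τ (lamRow θ u) - enDefect σ Φ z ℓ s τ (lam4Row θ)| ≤
      τ * ω * (4 + 6 * kineticPP z) :=
    logProfileObs_orbit_expansion hη₀ hFa hEq hσ hE ht hband Φ hz hn hs hτ hst hℓ0 hℓ hω hmod hIM hMF hIE
      hEF hIB hsl
  -- (2) the Euler side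
  have hEul := hEside hs hsτ hst
  -- (3) the flux remainder, integrated over the window
  have hIEi : IntervalIntegrable (fun r => ∫ x, eulerRate σ T ρ θ u r x) volume s (s + τ) :=
    (hEcont.mono hwin).intervalIntegrable_of_Icc hsτ
  have hpt : ∀ r ∈ Set.Icc s (s + τ),
      |(∫ x, ballRate σ T ρ θ u r ℓ (Φ.flow r z) x) - ∫ x, eulerRate σ T ρ θ u r x| ≤
        C * (1 + L) * fluctuationE ℓ (ρ r) (θ r) (u r) (Φ.flow r z) + C * cubicTail L (Φ.flow r z) :=
    fun r hr => by
    obtain ⟨hBi, hEi, hb⟩ := hFR r (hwin hr) hℓ0 hℓ hL (Φ.flow r z) (hcap r hr)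
    rw [← integral_sub hBi hEi]
    exact abs_integral_le_integral_abs.trans hb
  have hrem : |(∫ r in s..(s + τ), ∫ x, ballRate σ T ρ θ u r ℓ (Φ.flow r z) x) -
      ∫ r in s..(s + τ), ∫ x, eulerRate σ T ρ θ u r x| ≤
      C * (1 + L) * (∫ r in s..(s + τ), fluctuationE ℓ (ρ r) (θ r) (u r) (Φ.flow r z)) +
        C * (∫ r in s..(s + τ), cubicTail L (Φ.flow r z)) := by
    rw [← intervalIntegral.integral_sub hIB hIEi, ← intervalIntegral.integral_const_mul,
      ← intervalIntegral.integral_const_mul,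
      ← intervalIntegral.integral_add (hIF.const_mul (C * (1 + L))) (hIT.const_mul C)]
    refine (intervalIntegral.abs_integral_le_integral_abs hsτ).trans ?_
    exact intervalIntegral.integral_mono_on hsτ (hIB.sub hIEi).abs
      ((hIF.const_mul (C * (1 + L))).add (hIT.const_mul C)) fun r hr => hpt r hr
  -- (4) assemble
  exact xn_assemble hexp hEul hrem

end Summit.AtomisticToContinuum.HydrodynamicLimit.Theorems.NearConstantShortTimeHL

end
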